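import Summits.ResolutionOfSingularities.ResolutionOfSingularities.Theorems.EquisingularLiftEquisingularLiftNatAEvenTower
import HarnessLib

/-!
# [OURS] THE `D`-SERIES IN EXACT TRINOMIAL ARITHMETIC, I: charts, Jacobian analysis and rational marks of `f_m = y₀²y₁ + y₀y₁^{m+2} + y₂²` (`D_{2m+4}`)
# (cruxes `Theses.EquisingularLift.EquisingularLiftNat` / `…NatThree` / `EquisingularLift`, stmt-ResolutionOfSingularities-20038 / -20148 / -15660)

[OURS · leafhand-res-equisingularlift-12 g1, 2026-09-01; cell `pub/decomp-res`] AI-produced, weaker than expert review; NOT a statement of any manuscript;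
nothing here proves resolution of singularities in positive characteristic.  DEF-FREE helper; no `sorry`; standard axioms; ZERO named hypotheses.

Pure algebra feeding ✓ `OneStep.towerLevel_succ_origin_marked` (the all-levels marked engine of leafhand-12 g0) for the EVEN `D`-SERIES with the double
plane `y₂²` as tangent cone and the binary cubic `y₀y₁(y₀ + y₁)` (three RATIONAL tangent directions), every field, every characteristic:

* `sq_chart_vacuous₂` — for `f = y₂² + Ψ`, `Ψ ∈ (y)³`, the chart of the squared variable is EMPTY over the origin (`G ≡ 1 (mod T₂)`);
* `node_cone_C`, `node_firstOrder_C`, `node_oneStep_C` — the node `c·T₀T₁ + T₂²` (`c ≠ 0`) with any cubic form and any `(T)⁴`-tail is a one-step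
  point in EVERY characteristic (✓ `FirstOrderPoint.exists_strictTransform`; the prime-ideal criterion uses `∂₀, ∂₁` only);
* `monomial_mem_pow₃`, `D_even_tail_mem_pow` — order bookkeeping;
* `D_even_strictTransform₀/₁`, `D₄'_strictTransform₁` — `f_m(T₀, T₀T₁, T₀T₂) = T₀²·(T₀T₁ + T₂² + T₀·T₀^mT₁^{m+2})` (a node with tail),
  `f_{m+1}(T₁T₀, T₁, T₁T₂) = T₁²·f_m(T)` LITERALLY, and the `D₄` chart `1`;
* `D_even_jac₀/₁`, `D₄'_jac₁`, `D₄'_marks`, `forall_X_sub_C_zero_mem`, `aeval_translate_zero`, `D₄'_translate₀/₁` — singular points of the strict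
  transforms on the exceptional divisor sit at the origin (and, for `D₄`, also at the rational mark `-1`), and the translates to the marks are nodes
  `(-1)·T₀T₁ + T₂² + (cubic)`.

Sequel: ✓ `…NatDEvenTower` (`towerLevel_origin_D₄`, `towerLevel_origin_D_even`).  Honest label: pure algebra; closes no registered stub.

References: [Hartshorne1977, I Thm. 5.1, I Ex. 5.6, II Ex. 7.12]; [Lipman1969, §24]; through the cited tree files.
-/

set_option linter.dupNamespace false -- mandated namespace `Summit.<Summit>.<Problem>` of this single-conjunct summit

noncomputable section

open CategoryTheory CategoryTheory.Limits AlgebraicGeometry TopologicalSpace Topology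
open MvPolynomial
open Literature.AlgebraicGeometry.Resolution
open AlgebraicGeometry.Scheme.IdealSheafData

namespace Summit.ResolutionOfSingularities.ResolutionOfSingularities.Cruxes.EquisingularLiftNat.Sections

namespace SecondOrderPoint

variable (K : Type) [Field K]

/-! ## Generic bricks: the empty chart of a double plane, and nodes with a unit coefficient -/

/-- **The chart of the squared variable is EMPTY over the origin**: for `f = y₂² + Ψ`, `Ψ ∈ (y)³`, `f(T₂T₀, T₂T₁, T₂) = T₂²·G` with `G ≡ 1 (mod T₂)`, so no
prime contains both `T₂` and `G`. [cite: Hartshorne1977, II Ex. 7.12] -/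
theorem sq_chart_vacuous₂ {Ψ : MvPolynomial (Fin 3) K} (hΨ : Ψ ∈ Ideal.span (Set.range (X : Fin 3 → MvPolynomial (Fin 3) K)) ^ 3) :
    ∃ G : MvPolynomial (Fin 3) K,
      aeval (fun j => X 2 * Function.update (X : Fin 3 → MvPolynomial (Fin 3) K) 2 1 j) (X 2 ^ 2 + Ψ) = X 2 ^ 2 * G ∧
      ∀ P : Ideal (MvPolynomial (Fin 3) K), P.IsPrime → (X 2 : MvPolynomial (Fin 3) K) ∈ P → G ∈ P → False := by
  obtain ⟨R, hR⟩ := FirstOrderPoint.exists_aeval_subst_eq_pow_mul K 2 hΨ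
  refine ⟨1 + X 2 * R, ?_, fun P hP h2 hG => ?_⟩
  · rw [map_add, hR, map_pow, aeval_X, Function.update_self]
    ring
  · have h1 : (1 : MvPolynomial (Fin 3) K) = (1 + X 2 * R) - X 2 * R := by ring
    exact hP.ne_top ((Ideal.eq_top_iff_one P).mpr (h1 ▸ P.sub_mem hG (P.mul_mem_right _ h2)))

/-- The node cone `c·T₀T₁ + T₂²` is a non-zero quadratic form. [folklore] -/
theorem node_cone_C (c : K) :
    (C c * (X 0 * X 1) + X 2 ^ 2 : MvPolynomial (Fin 3) K).IsHomogeneous 2 ∧ (C c * (X 0 * X 1) + X 2 ^ 2 : MvPolynomial (Fin 3) K) ≠ 0 := by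
  refine ⟨?_, fun h => ?_⟩
  · refine IsHomogeneous.add ?_ (isHomogeneous_X_pow (2 : Fin 3) 2)
    simpa using (isHomogeneous_C (Fin 3) c).mul ((isHomogeneous_X K (0 : Fin 3)).mul (isHomogeneous_X K (1 : Fin 3)))
  · have h1 := congrArg (eval (Pi.single (2 : Fin 3) (1 : K))) h
    simp at h1

/-- **The node cone `c·T₀T₁ + T₂²` (`c ≠ 0`) is first-order in EVERY characteristic**, for any next form: a prime containing the cone, `∂₀ = cT₁` and
`∂₁ = cT₀` contains `T₂²`. [cite: Hartshorne1977, I Thm. 5.1] -/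
theorem node_firstOrder_C {c : K} (hc : c ≠ 0) (Ψ₁ : MvPolynomial (Fin 3) K) (P : Ideal (MvPolynomial (Fin 3) K)) (hP : P.IsPrime)
    (hΦ : (C c * (X 0 * X 1) + X 2 ^ 2 : MvPolynomial (Fin 3) K) ∈ P) (hd : ∀ i, pderiv i (C c * (X 0 * X 1) + X 2 ^ 2 : MvPolynomial (Fin 3) K) ∈ P)
    (_hΨ : Ψ₁ ∈ P) (i : Fin 3) : (X i : MvPolynomial (Fin 3) K) ∈ P := by
  have hd0 : pderiv 0 (C c * (X 0 * X 1) + X 2 ^ 2 : MvPolynomial (Fin 3) K) = C c * X 1 := by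
    rw [map_add, pderiv_mul, pderiv_C, pderiv_mul, pderiv_X_self, pderiv_X_of_ne (by decide : (1 : Fin 3) ≠ 0), pderiv_pow,
      pderiv_X_of_ne (by decide : (2 : Fin 3) ≠ 0)]
    ring
  have hd1 : pderiv 1 (C c * (X 0 * X 1) + X 2 ^ 2 : MvPolynomial (Fin 3) K) = C c * X 0 := by
    rw [map_add, pderiv_mul, pderiv_C, pderiv_mul, pderiv_X_of_ne (by decide : (0 : Fin 3) ≠ 1), pderiv_X_self, pderiv_pow,
      pderiv_X_of_ne (by decide : (2 : Fin 3) ≠ 1)]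
    ring
  have hX1 : (X 1 : MvPolynomial (Fin 3) K) ∈ P := mem_of_C_mul_mem K hc P hP (by rw [← hd0]; exact hd 0)
  have hX0 : (X 0 : MvPolynomial (Fin 3) K) ∈ P := mem_of_C_mul_mem K hc P hP (by rw [← hd1]; exact hd 1)
  have hX2 : (X 2 : MvPolynomial (Fin 3) K) ∈ P := by
    refine hP.mem_of_pow_mem 2 ?_
    have e : (X 2 ^ 2 : MvPolynomial (Fin 3) K) = (C c * (X 0 * X 1) + X 2 ^ 2) - C c * (X 0 * X 1) := by ring
    rw [e]
    exact P.sub_mem hΦ (P.mul_mem_left _ (P.mul_mem_right _ hX0))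
  fin_cases i
  · simpa using hX0
  · simpa using hX1
  · simpa using hX2

/-- ★ **ONE-STEP DATA FOR A NODE WITH A UNIT COEFFICIENT**: `(c·T₀T₁ + T₂²) + (Ψ₁ + Ψ'')`, `c ≠ 0`, `Ψ₁` a cubic form, `Ψ'' ∈ (T)⁴`, every characteristic
(✓ `FirstOrderPoint.exists_strictTransform`). [cite: Hartshorne1977, I Thm. 5.1, II Ex. 7.12] -/
theorem node_oneStep_C {c : K} (hc : c ≠ 0) (Ψ₁ Ψ'' : MvPolynomial (Fin 3) K) (hΨ₁ : Ψ₁.IsHomogeneous 3)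
    (hΨ'' : Ψ'' ∈ Ideal.span (Set.range (X : Fin 3 → MvPolynomial (Fin 3) K)) ^ 4) (b : Fin 3) :
    ∃ G' : MvPolynomial (Fin 3) K,
      aeval (fun j => X b * Function.update (X : Fin 3 → MvPolynomial (Fin 3) K) b 1 j) ((C c * (X 0 * X 1) + X 2 ^ 2) + (Ψ₁ + Ψ'')) = X b ^ 2 * G' ∧
      ∀ P : Ideal (MvPolynomial (Fin 3) K), P.IsPrime → (X b : MvPolynomial (Fin 3) K) ∈ P → G' ∈ P → ∃ j, pderiv j G' ∉ P :=
  FirstOrderPoint.exists_strictTransform K (C c * (X 0 * X 1) + X 2 ^ 2) Ψ₁ Ψ'' (node_cone_C K c).1 hΨ₁ hΨ''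
    (fun P hP hΦP hdP hΨP => node_firstOrder_C K hc Ψ₁ P hP hΦP hdP hΨP) b

/-- Monomials of degree `≥ k` lie in `(T)^k` (three variables). [folklore] -/
theorem monomial_mem_pow₃ (a b c : ℕ) {k : ℕ} (hk : k ≤ a + b + c) :
    (X 0 ^ a * X 1 ^ b * X 2 ^ c : MvPolynomial (Fin 3) K) ∈ Ideal.span (Set.range (X : Fin 3 → MvPolynomial (Fin 3) K)) ^ k := by
  set I : Ideal (MvPolynomial (Fin 3) K) := Ideal.span (Set.range (X : Fin 3 → MvPolynomial (Fin 3) K)) with hI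
  have hX : ∀ i : Fin 3, (X i : MvPolynomial (Fin 3) K) ∈ I := fun i => Ideal.subset_span (Set.mem_range_self i)
  refine Ideal.pow_le_pow_right hk ?_
  rw [pow_add, pow_add]
  exact Ideal.mul_mem_mul (Ideal.mul_mem_mul (Ideal.pow_mem_pow (hX 0) a) (Ideal.pow_mem_pow (hX 1) b)) (Ideal.pow_mem_pow (hX 2) c)

/-! ## The even `D`-series `f_m = y₀²y₁ + y₀y₁^{m+2} + y₂²`: charts -/

/-- The tail `y₀²y₁ + y₀y₁^{m+2}` lies in `(y)³`. [folklore] -/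
theorem D_even_tail_mem_pow (m : ℕ) :
    (X 0 ^ 2 * X 1 + X 0 * X 1 ^ (m + 2) : MvPolynomial (Fin 3) K) ∈ Ideal.span (Set.range (X : Fin 3 → MvPolynomial (Fin 3) K)) ^ (2 + 1) := by
  refine Ideal.add_mem _ ?_ ?_
  · simpa using monomial_mem_pow₃ K 2 1 0 (k := 2 + 1) (by norm_num)
  · simpa using monomial_mem_pow₃ K 1 (m + 2) 0 (k := 2 + 1) (by omega)

/-- **Chart `0` of `f_m`**: `f_m(T₀, T₀T₁, T₀T₂) = T₀²·(T₀T₁ + T₂² + T₀·(T₀^m T₁^{m+2}))`. [cite: Hartshorne1977, II Ex. 7.12] -/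
theorem D_even_strictTransform₀ (m : ℕ) :
    aeval (fun j => X 0 * Function.update (X : Fin 3 → MvPolynomial (Fin 3) K) 0 1 j)
        (X 2 ^ 2 + (X 0 ^ 2 * X 1 + X 0 * X 1 ^ (m + 2)) : MvPolynomial (Fin 3) K) =
      X 0 ^ 2 * (X 0 * X 1 + X 2 ^ 2 + X 0 * (X 0 ^ m * X 1 ^ (m + 2))) := by
  simp only [map_add, map_mul, map_pow, aeval_X, Function.update_self, Function.update_of_ne (by decide : (1 : Fin 3) ≠ 0),
    Function.update_of_ne (by decide : (2 : Fin 3) ≠ 0)]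
  ring

/-- **Chart `1` of `f_{m+1}`**: `f_{m+1}(T₁T₀, T₁, T₁T₂) = T₁²·(T₂² + T₁·(T₀² + T₀T₁^{m+1}))` — which is `f_m`. [cite: Hartshorne1977, II Ex. 7.12] -/
theorem D_even_strictTransform₁ (m : ℕ) :
    aeval (fun j => X 1 * Function.update (X : Fin 3 → MvPolynomial (Fin 3) K) 1 1 j)
        (X 2 ^ 2 + (X 0 ^ 2 * X 1 + X 0 * X 1 ^ (m + 3)) : MvPolynomial (Fin 3) K) =
      X 1 ^ 2 * (X 2 ^ 2 + X 1 * (X 0 ^ 2 + X 0 * X 1 ^ (m + 1))) := by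
  simp only [map_add, map_mul, map_pow, aeval_X, Function.update_self, Function.update_of_ne (by decide : (0 : Fin 3) ≠ 1),
    Function.update_of_ne (by decide : (2 : Fin 3) ≠ 1)]
  ring

/-- **Chart `1` of `f_0 = D₄`**: `f_0(T₁T₀, T₁, T₁T₂) = T₁²·(T₀T₁ + T₂² + T₁·T₀²)`. [cite: Hartshorne1977, II Ex. 7.12] -/
theorem D₄'_strictTransform₁ :
    aeval (fun j => X 1 * Function.update (X : Fin 3 → MvPolynomial (Fin 3) K) 1 1 j)
        (X 2 ^ 2 + (X 0 ^ 2 * X 1 + X 0 * X 1 ^ (0 + 2)) : MvPolynomial (Fin 3) K) =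
      X 1 ^ 2 * (X 0 * X 1 + X 2 ^ 2 + X 1 * (X 1 ^ 0 * X 0 ^ (0 + 2))) := by
  simp only [map_add, map_mul, map_pow, aeval_X, Function.update_self, Function.update_of_ne (by decide : (0 : Fin 3) ≠ 1),
    Function.update_of_ne (by decide : (2 : Fin 3) ≠ 1)]
  ring

/-! ## Jacobian analysis along the exceptional divisor -/

/-- **Chart `0`, mark analysis**: for `G₀ = T₀T₁ + T₂² + T₀·(T₀^m T₁^{m+2})`, a prime containing `T₀`, `G₀` and all `∂_jG₀` contains `T₂` and
`T₁·(1 + T₀^m T₁^{m+1})`; hence all `T_i` if `m ≥ 1`, and `T_i` or `(T₀, T₁ + 1, T₂)` if `m = 0`. [cite: Hartshorne1977, I Thm. 5.1] -/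
theorem D_even_jac₀ (m : ℕ) (P : Ideal (MvPolynomial (Fin 3) K)) (hP : P.IsPrime) (h0 : (X 0 : MvPolynomial (Fin 3) K) ∈ P)
    (hG : (X 0 * X 1 + X 2 ^ 2 + X 0 * (X 0 ^ m * X 1 ^ (m + 2)) : MvPolynomial (Fin 3) K) ∈ P)
    (hd : ∀ j, pderiv j (X 0 * X 1 + X 2 ^ 2 + X 0 * (X 0 ^ m * X 1 ^ (m + 2)) : MvPolynomial (Fin 3) K) ∈ P) :
    (X 2 : MvPolynomial (Fin 3) K) ∈ P ∧ (X 1 * (1 + X 0 ^ m * X 1 ^ (m + 1)) : MvPolynomial (Fin 3) K) ∈ P := by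
  refine ⟨?_, ?_⟩
  · refine hP.mem_of_pow_mem 2 ?_
    have e : (X 2 ^ 2 : MvPolynomial (Fin 3) K) = (X 0 * X 1 + X 2 ^ 2 + X 0 * (X 0 ^ m * X 1 ^ (m + 2))) - X 0 * (X 1 + X 0 ^ m * X 1 ^ (m + 2)) := by
      ring
    rw [e]
    exact P.sub_mem hG (P.mul_mem_right _ h0)
  · have h := hd 0
    rw [map_add, map_add, pderiv_mul, pderiv_X_self, pderiv_X_of_ne (by decide : (1 : Fin 3) ≠ 0), pderiv_pow,
      pderiv_X_of_ne (by decide : (2 : Fin 3) ≠ 0), pderiv_mul, pderiv_X_self] at h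
    have e : (X 1 * (1 + X 0 ^ m * X 1 ^ (m + 1)) : MvPolynomial (Fin 3) K) =
        (1 * X 1 + X 0 * 0 + ↑2 * X 2 ^ (2 - 1) * 0 + (1 * (X 0 ^ m * X 1 ^ (m + 2)) + X 0 * pderiv 0 (X 0 ^ m * X 1 ^ (m + 2)))) -
          X 0 * pderiv 0 (X 0 ^ m * X 1 ^ (m + 2)) := by ring
    rw [e]
    exact P.sub_mem h (P.mul_mem_right _ h0)

/-- **Chart `1`, mark analysis**: for `G₁ = T₂² + T₁·(T₀² + T₀T₁^{m+1})`, a prime containing `T₁`, `G₁` and all `∂_jG₁` contains `T₂` and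
`T₀·(T₀ + T₁^{m+1})`. [cite: Hartshorne1977, I Thm. 5.1] -/
theorem D_even_jac₁ (m : ℕ) (P : Ideal (MvPolynomial (Fin 3) K)) (hP : P.IsPrime) (h1 : (X 1 : MvPolynomial (Fin 3) K) ∈ P)
    (hG : (X 2 ^ 2 + X 1 * (X 0 ^ 2 + X 0 * X 1 ^ (m + 1)) : MvPolynomial (Fin 3) K) ∈ P)
    (hd : ∀ j, pderiv j (X 2 ^ 2 + X 1 * (X 0 ^ 2 + X 0 * X 1 ^ (m + 1)) : MvPolynomial (Fin 3) K) ∈ P) :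
    (X 2 : MvPolynomial (Fin 3) K) ∈ P ∧ (X 0 * (X 0 + X 1 ^ (m + 1)) : MvPolynomial (Fin 3) K) ∈ P := by
  refine ⟨?_, ?_⟩
  · refine hP.mem_of_pow_mem 2 ?_
    have e : (X 2 ^ 2 : MvPolynomial (Fin 3) K) = (X 2 ^ 2 + X 1 * (X 0 ^ 2 + X 0 * X 1 ^ (m + 1))) - X 1 * (X 0 ^ 2 + X 0 * X 1 ^ (m + 1)) := by
      ring
    rw [e]
    exact P.sub_mem hG (P.mul_mem_right _ h1)
  · have h := hd 1
    rw [map_add, pderiv_pow, pderiv_X_of_ne (by decide : (2 : Fin 3) ≠ 1), pderiv_mul, pderiv_X_self] at h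
    have e : (X 0 * (X 0 + X 1 ^ (m + 1)) : MvPolynomial (Fin 3) K) =
        (↑2 * X 2 ^ (2 - 1) * 0 + (1 * (X 0 ^ 2 + X 0 * X 1 ^ (m + 1)) + X 1 * pderiv 1 (X 0 ^ 2 + X 0 * X 1 ^ (m + 1)))) -
          X 1 * pderiv 1 (X 0 ^ 2 + X 0 * X 1 ^ (m + 1)) := by ring
    rw [e]
    exact P.sub_mem h (P.mul_mem_right _ h1)

/-- **Chart `1` of `D₄`, mark analysis** (the mirror image of `D_even_jac₀` at `m = 0` under `T₀ ↔ T₁`): for `G₁ = T₀T₁ + T₂² + T₁·(T₁⁰T₀²)`, a prime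
containing `T₁`, `G₁` and all `∂_jG₁` contains `T₂` and `T₀(1 + T₀)`. [cite: Hartshorne1977, I Thm. 5.1] -/
theorem D₄'_jac₁ (P : Ideal (MvPolynomial (Fin 3) K)) (hP : P.IsPrime) (h1 : (X 1 : MvPolynomial (Fin 3) K) ∈ P)
    (hG : (X 0 * X 1 + X 2 ^ 2 + X 1 * (X 1 ^ 0 * X 0 ^ (0 + 2)) : MvPolynomial (Fin 3) K) ∈ P)
    (hd : ∀ j, pderiv j (X 0 * X 1 + X 2 ^ 2 + X 1 * (X 1 ^ 0 * X 0 ^ (0 + 2)) : MvPolynomial (Fin 3) K) ∈ P) :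
    (X 2 : MvPolynomial (Fin 3) K) ∈ P ∧ (X 0 * (1 + X 1 ^ 0 * X 0 ^ (0 + 1)) : MvPolynomial (Fin 3) K) ∈ P := by
  refine ⟨?_, ?_⟩
  · refine hP.mem_of_pow_mem 2 ?_
    have e : (X 2 ^ 2 : MvPolynomial (Fin 3) K) = (X 0 * X 1 + X 2 ^ 2 + X 1 * (X 1 ^ 0 * X 0 ^ (0 + 2))) - X 1 * (X 0 + X 0 ^ 2) := by
      ring
    rw [e]
    exact P.sub_mem hG (P.mul_mem_right _ h1)
  · have h := hd 1
    rw [map_add, map_add, pderiv_mul, pderiv_X_of_ne (by decide : (0 : Fin 3) ≠ 1), pderiv_X_self, pderiv_pow,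
      pderiv_X_of_ne (by decide : (2 : Fin 3) ≠ 1), pderiv_mul, pderiv_X_self] at h
    have e : (X 0 * (1 + X 1 ^ 0 * X 0 ^ (0 + 1)) : MvPolynomial (Fin 3) K) =
        (0 * X 1 + X 0 * 1 + ↑2 * X 2 ^ (2 - 1) * 0 + (1 * (X 1 ^ 0 * X 0 ^ (0 + 2)) + X 1 * pderiv 1 (X 1 ^ 0 * X 0 ^ (0 + 2)))) -
          X 1 * pderiv 1 (X 1 ^ 0 * X 0 ^ (0 + 2)) := by ring
    rw [e]
    exact P.sub_mem h (P.mul_mem_right _ h1)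

/-- All variables from `T₀, T₁, T₂ ∈ P`, as the engine wants them: `T_i - C(0_i) ∈ P`. [folklore] -/
theorem forall_X_sub_C_zero_mem (P : Ideal (MvPolynomial (Fin 3) K)) (h0 : (X 0 : MvPolynomial (Fin 3) K) ∈ P)
    (h1 : (X 1 : MvPolynomial (Fin 3) K) ∈ P) (h2 : (X 2 : MvPolynomial (Fin 3) K) ∈ P) (i : Fin 3) :
    (X i - C ((0 : Fin 3 → K) i) : MvPolynomial (Fin 3) K) ∈ P := by
  fin_cases i
  · simpa using h0
  · simpa using h1
  · simpa using h2

/-- The translate to the origin is the identity. [folklore] -/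
theorem aeval_translate_zero (G : MvPolynomial (Fin 3) K) : aeval (fun i : Fin 3 => X i + C ((0 : Fin 3 → K) i)) G = G := by
  have h0 : (fun i : Fin 3 => X i + C ((0 : Fin 3 → K) i)) = (X : Fin 3 → MvPolynomial (Fin 3) K) := by
    funext i; simp
  simp only [h0, MvPolynomial.aeval_X_left, AlgHom.coe_id, id_eq]

/-! ## `D₄`: the second mark `-1` in charts `0` and `1` -/

/-- **Chart `0` of `D₄` translated to the mark `(0,-1,0)`**: `G₀(T₀, T₁ - 1, T₂) = ((-1)·T₀T₁ + T₂²) + (T₀T₁² + 0)` for `G₀ = T₀T₁ + T₂² + T₀·(T₀⁰T₁²)`.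
[folklore] -/
theorem D₄'_translate₀ :
    aeval (fun i => X i + C ((- (Pi.single (1 : Fin 3) (1 : K)) : Fin 3 → K) i))
        (X 0 * X 1 + X 2 ^ 2 + X 0 * (X 0 ^ 0 * X 1 ^ (0 + 2)) : MvPolynomial (Fin 3) K) =
      (C (-1 : K) * (X 0 * X 1) + X 2 ^ 2) + (X 0 * X 1 ^ 2 + 0) := by
  simp only [map_add, map_mul, map_pow, aeval_X, Pi.neg_apply, Pi.single_eq_same, Pi.single_eq_of_ne (by decide : (0 : Fin 3) ≠ 1),
    Pi.single_eq_of_ne (by decide : (2 : Fin 3) ≠ 1), neg_zero, map_zero, add_zero, map_neg, map_one]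
  ring

/-- **Chart `1` of `D₄` translated to the mark `(-1,0,0)`**: `G₁(T₀ - 1, T₁, T₂) = ((-1)·T₀T₁ + T₂²) + (T₀²T₁ + 0)` for `G₁ = T₀T₁ + T₂² + T₁·(T₁⁰T₀²)`.
[folklore] -/
theorem D₄'_translate₁ :
    aeval (fun i => X i + C ((- (Pi.single (0 : Fin 3) (1 : K)) : Fin 3 → K) i))
        (X 0 * X 1 + X 2 ^ 2 + X 1 * (X 1 ^ 0 * X 0 ^ (0 + 2)) : MvPolynomial (Fin 3) K) =
      (C (-1 : K) * (X 0 * X 1) + X 2 ^ 2) + (X 0 ^ 2 * X 1 + 0) := by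
  simp only [map_add, map_mul, map_pow, aeval_X, Pi.neg_apply, Pi.single_eq_same, Pi.single_eq_of_ne (by decide : (1 : Fin 3) ≠ 0),
    Pi.single_eq_of_ne (by decide : (2 : Fin 3) ≠ 0), neg_zero, map_zero, add_zero, map_neg, map_one]
  ring

/-- **Mark analysis for `D₄`, both charts** (the charts are exchanged by `T₀ ↔ T₁`): for `G = T₀T₁ + T₂² + T_l·(T_l⁰ T_j²)` (`{l, j} = {0, 1}`), a prime
containing `T_l`, `G`, all `∂G` contains `T₂` and `T_j(1 + T_j)`, so it contains every `T_i - 0` or every `T_i - λ_i` with `λ = -e_j`.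
[cite: Hartshorne1977, I Thm. 5.1] -/
theorem D₄'_marks (P : Ideal (MvPolynomial (Fin 3) K)) (hP : P.IsPrime) {l j : Fin 3} (hj2 : j ≠ 2) (hl2 : l ≠ 2) (hlj : l ≠ j)
    (hl : (X l : MvPolynomial (Fin 3) K) ∈ P) (h2 : (X 2 : MvPolynomial (Fin 3) K) ∈ P)
    (hj : (X j * (1 + X l ^ 0 * X j ^ (0 + 1)) : MvPolynomial (Fin 3) K) ∈ P) :
    (∀ i, (X i - C ((0 : Fin 3 → K) i) : MvPolynomial (Fin 3) K) ∈ P) ∨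
      ∀ i, (X i - C ((- (Pi.single j (1 : K)) : Fin 3 → K) i) : MvPolynomial (Fin 3) K) ∈ P := by
  rw [pow_zero, one_mul, zero_add, pow_one] at hj
  have hall : ∀ i : Fin 3, i = l ∨ i = j ∨ i = 2 := by
    intro i
    fin_cases i <;> fin_cases l <;> fin_cases j <;> simp_all
  rcases hP.mem_or_mem hj with h | h
  · left
    intro i
    rcases hall i with rfl | rfl | rfl
    · simpa using hl
    · simpa using h
    · simpa using h2
  · right
    intro i
    rcases hall i with rfl | rfl | rfl
    · simpa [Pi.single_eq_of_ne hlj] using hl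
    · have e : (X i - C ((- (Pi.single i (1 : K)) : Fin 3 → K) i) : MvPolynomial (Fin 3) K) = 1 + X i := by
        simp only [Pi.neg_apply, Pi.single_eq_same, map_neg, map_one]
        ring
      rw [e]
      exact h
    · simpa [Pi.single_eq_of_ne (Ne.symm hj2)] using h2

end SecondOrderPoint

end Summit.ResolutionOfSingularities.ResolutionOfSingularities.Cruxes.EquisingularLiftNat.Sections

end
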